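import Summits.CriticalPhenomena.PercolationContinuityZ3.Theorems.PercNearOneGluingNoHeavyQuantTwoLayerCertificate
import Summits.CriticalPhenomena.PercolationContinuityZ3.Theorems.PercNearOneGluingNoHeavyQuantTwoLayerHalfPointwise
import Summits.CriticalPhenomena.PercolationContinuityZ3.Theorems.PercNearOneGluingNoHeavyQuantTwoLayerHalfRows
import Summits.CriticalPhenomena.PercolationContinuityZ3.Theorems.PercNearOneGluingNoHeavyQuantTwoLayerHalfNeed
import Summits.CriticalPhenomena.PercolationContinuityZ3.Theorems.PercNearOneGluingNoHeavyQuantDeepLowsGiants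
import HarnessLib

/-!
# QUANT lane R8 on trees: THEOREM A — the two-layer tail class at floor `y ≥ 1/2` is closed under convolution (`q = 1`)

builds on p205010 (kernel theorem, internal audit signed; external expert review pending)

Support file (`--supports stmt-CriticalPhenomena-4575`), QUANT lane seat prim-quant-arm-2 (gen 38); memo
`run/shared/lean/prim/quant/prim-quant-arm-2-g38/TWO-LAYER-CLOSURE-G38.md` §7, §11–§12 and `THEOREM-A-PROOF.md`.  Theorems only, standard axioms.
**`LawDec.twoLayer_lconv_of_half_le`**: for `1/2 ≤ y < 1` and probability laws `μ₁`, `μ₂` on `{0..M₁}`, `{0..M₂}` whose two-layer families hold at floor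
`y` with thresholds their means, `gate (lconv M₁ M₂ μ₁ μ₂) 1` satisfies the two-layer family at floor `y`, threshold `T₁ + T₂` — the `q = 1`, `y ≥ 1/2`
instance of `TwoLayerConvClosed` (`…QuantTwoLayerClosure`), with NO top-affordability.  Proof: `twoLayer_pair_of_certificate` (`…TwoLayerCertificate`)
with the row weights of S* (`halfRows_*`, extended by `c s = k − s` on the phantom rows `M₂ < s ≤ k`), the layer cake of the column profile (`need_*`),
zero tilts, and `halfCert_pointwise`.  HONEST STATUS: `TwoLayerConvClosed` (general `q`, `y`), `TreeBuiltFAR`, `FarTreeRow` OPEN; RATE class log\*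
and the honest sentence of `run/shared/lean/prim/quant/README.md` unchanged.
[this work].  The gluing rows served [cite: KozmaNitzan2024, Conjecture 3 (p. 15)]; product measure [cite: Grimmett1999, §1.3 p. 10].
-/

noncomputable section

open scoped Classical

namespace Summit.CriticalPhenomena.PercolationContinuityZ3.Theorems

namespace Quant

open Finset

namespace LawDec

/-- a drop of the profile at `c` witnesses a U- or W-cell AT `c`. [this work] -/
theorem need_drop_witness (U W : ℕ → ℕ → Prop) (r : ℝ) (K a c : ℕ)
    (hne : (if ∃ s' ∈ Finset.Icc c K, U a s' then (1 : ℝ) else if ∃ s' ∈ Finset.Icc c K, W a s' then r else 0)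
      ≠ (if ∃ s' ∈ Finset.Icc (c + 1) K, U a s' then (1 : ℝ) else if ∃ s' ∈ Finset.Icc (c + 1) K, W a s' then r else 0)) :
    U a c ∨ W a c := by
  -- monotonicity of the existentials and the 'witness at c' dichotomy
  have monoU : (∃ s' ∈ Finset.Icc (c + 1) K, U a s') → (∃ s' ∈ Finset.Icc c K, U a s') := by
    rintro ⟨s', hs', h⟩; rw [Finset.mem_Icc] at hs'; exact ⟨s', Finset.mem_Icc.2 ⟨by omega, hs'.2⟩, h⟩
  have monoW : (∃ s' ∈ Finset.Icc (c + 1) K, W a s') → (∃ s' ∈ Finset.Icc c K, W a s') := by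
    rintro ⟨s', hs', h⟩; rw [Finset.mem_Icc] at hs'; exact ⟨s', Finset.mem_Icc.2 ⟨by omega, hs'.2⟩, h⟩
  have downU : (∃ s' ∈ Finset.Icc c K, U a s') → ¬ (∃ s' ∈ Finset.Icc (c + 1) K, U a s') → U a c := by
    rintro ⟨s', hs', h⟩ hno; rw [Finset.mem_Icc] at hs'
    rcases Nat.eq_or_lt_of_le hs'.1 with heq | hlt
    · exact heq ▸ h
    · exact (hno ⟨s', Finset.mem_Icc.2 ⟨hlt, hs'.2⟩, h⟩).elim
  have downW : (∃ s' ∈ Finset.Icc c K, W a s') → ¬ (∃ s' ∈ Finset.Icc (c + 1) K, W a s') → W a c := by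
    rintro ⟨s', hs', h⟩ hno; rw [Finset.mem_Icc] at hs'
    rcases Nat.eq_or_lt_of_le hs'.1 with heq | hlt
    · exact heq ▸ h
    · exact (hno ⟨s', Finset.mem_Icc.2 ⟨hlt, hs'.2⟩, h⟩).elim
  by_cases hU1 : ∃ s' ∈ Finset.Icc c K, U a s'
  · by_cases hU2 : ∃ s' ∈ Finset.Icc (c + 1) K, U a s'
    · rw [if_pos hU1, if_pos hU2] at hne; exact (hne rfl).elim
    · exact Or.inl (downU hU1 hU2)
  · have hU2 : ¬ ∃ s' ∈ Finset.Icc (c + 1) K, U a s' := fun h => hU1 (monoU h)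
    rw [if_neg hU1, if_neg hU2] at hne
    by_cases hW1 : ∃ s' ∈ Finset.Icc c K, W a s'
    · by_cases hW2 : ∃ s' ∈ Finset.Icc (c + 1) K, W a s'
      · rw [if_pos hW1, if_pos hW2] at hne; exact (hne rfl).elim
      · exact Or.inr (downW hW1 hW2)
    · have hW2 : ¬ ∃ s' ∈ Finset.Icc (c + 1) K, W a s' := fun h => hW1 (monoW h)
      rw [if_neg hW1, if_neg hW2] at hne; exact (hne rfl).elim

/-- **THEOREM A (arm-2 g38): at floor `y ≥ 1/2` the two-layer family is closed under convolution.**  `1/2 ≤ y < 1`; `μ₁`, `μ₂` probability laws on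
`{0..M₁}`, `{0..M₂}` satisfying the two-layer family at floor `y` with thresholds their means; then so does `lconv M₁ M₂ μ₁ μ₂` (written through
`gate · 1`, the `q = 1` binder of `TwoLayerConvClosed`). [this work] -/
theorem twoLayer_lconv_of_half_le (y : ℝ) (M₁ M₂ : ℕ) (μ₁ μ₂ : ℕ → ℝ) (hy : 1 / 2 ≤ y) (hy1 : y < 1)
    (h10 : ∀ h, 0 ≤ μ₁ h) (h11 : ∑ h ∈ Finset.range (M₁ + 1), μ₁ h = 1)
    (h20 : ∀ h, 0 ≤ μ₂ h) (h21 : ∑ h ∈ Finset.range (M₂ + 1), μ₂ h = 1)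
    (hB1 : ∀ j j' : ℕ, j' ≤ j → (j : ℝ) + j' < 1 * ∑ h ∈ Finset.range (M₁ + 1), (h : ℝ) * μ₁ h →
      y * ∑ h ∈ Finset.range (M₁ + 1), (if h ≤ j' then gate μ₁ 1 h else 0)
        ≤ (1 - y) * ∑ h ∈ Finset.range (M₁ + 1), (if j + 1 ≤ h then gate μ₁ 1 h else 0))
    (hB2 : ∀ j j' : ℕ, j' ≤ j → (j : ℝ) + j' < 1 * ∑ h ∈ Finset.range (M₂ + 1), (h : ℝ) * μ₂ h →
      y * ∑ h ∈ Finset.range (M₂ + 1), (if h ≤ j' then gate μ₂ 1 h else 0)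
        ≤ (1 - y) * ∑ h ∈ Finset.range (M₂ + 1), (if j + 1 ≤ h then gate μ₂ 1 h else 0))
    (i i' : ℕ) (hii : i' ≤ i)
    (hdeep : (i : ℝ) + i' < 1 * ((∑ h ∈ Finset.range (M₁ + 1), (h : ℝ) * μ₁ h) + ∑ h ∈ Finset.range (M₂ + 1), (h : ℝ) * μ₂ h)) :
    y * ∑ h ∈ Finset.range (M₁ + M₂ + 1), (if h ≤ i' then gate (lconv M₁ M₂ μ₁ μ₂) 1 h else 0)
      ≤ (1 - y) * ∑ h ∈ Finset.range (M₁ + M₂ + 1), (if i + 1 ≤ h then gate (lconv M₁ M₂ μ₁ μ₂) 1 h else 0) := by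
  set t₁ : ℝ := ∑ h ∈ Finset.range (M₁ + 1), (h : ℝ) * μ₁ h with ht₁
  set t₂ : ℝ := ∑ h ∈ Finset.range (M₂ + 1), (h : ℝ) * μ₂ h with ht₂
  set k : ℕ := i' with hk
  have hy0 : 0 < y := by linarith
  have hk2 : 2 * (k : ℝ) < t₁ + t₂ := by
    have : (i' : ℝ) ≤ i := by exact_mod_cast hii
    rw [one_mul] at hdeep
    rw [hk]; linarith
  have ht₁M : t₁ ≤ M₁ := lawMean_le_top M₁ μ₁ h10 h11
  have ht₂M : t₂ ≤ M₂ := lawMean_le_top M₂ μ₂ h20 h21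
  -- ROW DATA (S*, extended by `c = k − s` on the phantom rows `M₂ < s ≤ k`)
  let act : ℕ → Prop := fun s => s ≤ k ∧ (((k : ℝ) < t₁ + s ∧ 0 < t₁) ∨ M₂ < s)
  let c : ℕ → ℕ := fun s => if M₂ < s then k - s else min (k - s) (min (⌈t₁ / 2⌉₊ - 1) (⌈t₁ - k + s⌉₊ - 1))
  have hc_hi : ∀ s, M₂ < s → c s = k - s := fun s h => if_pos h
  have hc_lo : ∀ s, ¬ M₂ < s → c s = min (k - s) (min (⌈t₁ / 2⌉₊ - 1) (⌈t₁ - k + s⌉₊ - 1)) := fun s h => if_neg h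
  have H1 : ∀ s : ℕ, act s → 2 * (c s : ℝ) < t₁ := by
    intro s ⟨hs, hor⟩
    by_cases hM : M₂ < s
    · rw [hc_hi s hM, Nat.cast_sub hs]
      have hsM : (M₂ : ℝ) < s := by exact_mod_cast hM
      linarith
    · rw [hc_lo s hM]
      rcases hor with ⟨_, ht⟩ | hM'
      · exact halfRows_H1 t₁ k s ht
      · exact (hM hM').elim
  have H2 : ∀ s : ℕ, act s → c s + s ≤ k := by
    intro s ⟨hs, _⟩
    by_cases hM : M₂ < s
    · rw [hc_hi s hM]; omega
    · rw [hc_lo s hM]; exact halfRows_H2 t₁ k s hs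
  have H3 : ∀ s : ℕ, act s → (c s : ℝ) < t₁ - k + s := by
    intro s ⟨hs, hor⟩
    by_cases hM : M₂ < s
    · rw [hc_hi s hM, Nat.cast_sub hs]
      have hsM : (M₂ : ℝ) < s := by exact_mod_cast hM
      linarith
    · rw [hc_lo s hM]
      rcases hor with ⟨hks, _⟩ | hM'
      · exact halfRows_H3 t₁ k s hks
      · exact (hM hM').elim
  have H4 : ∀ a s : ℕ, a + s ≤ k → (¬ act s ∨ c s < a) → (t₁ ≤ 2 * (a : ℝ) ∨ t₁ - k + s ≤ (a : ℝ)) := by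
    intro a s hlow hunc
    by_cases hM : M₂ < s
    · exfalso
      rcases hunc with hna | hlt
      · exact hna ⟨by omega, Or.inr hM⟩
      · rw [hc_hi s hM] at hlt; omega
    · refine halfRows_H4 t₁ k a s hlow ?_
      rcases hunc with hna | hlt
      · left
        rintro ⟨hs, hks, ht⟩
        exact hna ⟨hs, Or.inl ⟨hks, ht⟩⟩
      · right; rw [hc_lo s hM] at hlt; exact hlt
  -- every low cell of a high row is covered (so U- and W-cells lie in low rows `2s < t₂` and in rows `≤ M₂`)
  have Hcov : ∀ a s : ℕ, a + s ≤ k → t₂ ≤ 2 * (s : ℝ) → act s ∧ a ≤ c s := by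
    intro a s hlow hhigh
    by_cases hM : M₂ < s
    · refine ⟨⟨by omega, Or.inr hM⟩, ?_⟩
      rw [hc_hi s hM]; omega
    · obtain ⟨⟨hs, hks, ht⟩, hle⟩ := halfRows_H6 t₁ t₂ k a s hk2 (by omega) hhigh hlow
      exact ⟨⟨hs, Or.inl ⟨hks, ht⟩⟩, by rw [hc_lo s hM]; exact hle⟩
  let U : ℕ → ℕ → Prop := fun a s => a + s ≤ k ∧ (¬ act s ∨ c s < a)
  let W : ℕ → ℕ → Prop := fun a s => act s ∧ t₁ - c s ≤ (a : ℝ) ∧ k < a + s ∧ (a : ℝ) + s < t₁ + t₂ - k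
  have hUW_low : ∀ a s, (U a s ∨ W a s) → 2 * (s : ℝ) < t₂ ∧ s ≤ M₂ := by
    intro a s h
    rcases h with ⟨hlow, hunc⟩ | ⟨hact, hge, _, hlt⟩
    · have h2s : 2 * (s : ℝ) < t₂ := by
        by_contra hh
        obtain ⟨hact, hle⟩ := Hcov a s hlow (not_lt.1 hh)
        rcases hunc with hna | hlt'
        · exact hna hact
        · omega
      refine ⟨h2s, ?_⟩
      by_contra hM
      have : (M₂ : ℝ) < s := by exact_mod_cast (not_le.1 hM)
      linarith
    · have h2 := H2 s hact
      have h2' : (c s : ℝ) + s ≤ k := by exact_mod_cast h2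
      have h2s : 2 * (s : ℝ) < t₂ := by linarith
      refine ⟨h2s, ?_⟩
      by_contra hM
      have : (M₂ : ℝ) < s := by exact_mod_cast (not_le.1 hM)
      linarith
  -- COLUMN PROFILE
  set r : ℝ := (1 - y) / y with hr
  have hr0 : 0 ≤ r := div_nonneg (by linarith) hy0.le
  have hr1 : r ≤ 1 := by rw [hr, div_le_one hy0]; linarith
  obtain ⟨need, hneed⟩ : ∃ need : ℕ → ℕ → ℝ, ∀ a s : ℕ, need a s =
      (if ∃ s' ∈ Finset.Icc s M₂, U a s' then (1 : ℝ) else if ∃ s' ∈ Finset.Icc s M₂, W a s' then r else 0) :=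
    ⟨fun a s => if ∃ s' ∈ Finset.Icc s M₂, U a s' then (1 : ℝ) else if ∃ s' ∈ Finset.Icc s M₂, W a s' then r else 0,
      fun a s => rfl⟩
  have N0 : ∀ a s : ℕ, 0 ≤ need a s := fun a s => by
    rw [hneed]
    convert need_nonneg U W r M₂ a s hr0 using 5
  have N1 : ∀ a s : ℕ, need a s ≤ 1 := fun a s => by
    rw [hneed]
    convert need_le_one U W r M₂ a s hr1 using 5
  have NU : ∀ a s : ℕ, a + s ≤ k → (¬ act s ∨ c s < a) → need a s = 1 := by
    intro a s hlow hunc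
    rw [hneed]
    convert need_eq_one_of_U U W r M₂ a s (hUW_low a s (Or.inl ⟨hlow, hunc⟩)).2 ⟨hlow, hunc⟩ using 5
  have NW : ∀ a s : ℕ, act s → t₁ - c s ≤ (a : ℝ) → k < a + s → (a : ℝ) + s < t₁ + t₂ - k → (1 - y) / y ≤ need a s := by
    intro a s hact hge hks hlt
    rw [hneed]
    convert need_ge_of_W U W r M₂ a s hr1 (hUW_low a s (Or.inr ⟨hact, hge, hks, hlt⟩)).2 ⟨hact, hge, hks, hlt⟩ using 5
  have Npos : ∀ a s : ℕ, 0 < need a s → ∃ s'', s ≤ s'' ∧ (U a s'' ∨ W a s'') := by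
    intro a s hpos
    rw [hneed] at hpos
    exact need_pos_witness U W r M₂ a s (by convert hpos using 5)
  have Nmono : ∀ a s s₂ : ℕ, s ≤ s₂ → need a s₂ ≤ need a s := fun a s s₂ hss => by
    rw [hneed, hneed]
    convert need_antitone U W r M₂ a s s₂ hr0 hr1 hss using 5
  have Nvan : ∀ a s : ℕ, M₂ < s → need a s = 0 := fun a s hs => by
    rw [hneed]
    convert need_eq_zero_of_lt U W r M₂ a s hs using 5
  let lam : ℕ → ℕ → ℕ → ℝ := fun j j' s => if act s ∧ j' = c s ∧ j + 1 = ⌈t₁ - (c s : ℝ)⌉₊ then 1 else 0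
  let kap : ℕ → ℕ → ℕ → ℝ := fun j j' a => if j + 1 = ⌈t₂ - (j' : ℝ)⌉₊ then need a j' - need a (j' + 1) else 0
  -- apply the principle with `q = 1` and zero tilts
  refine twoLayer_pair_of_certificate y 1 M₁ M₂ μ₁ μ₂ i i' h10 h11 h20 h21 hB1 hB2 lam kap (fun _ => 0) (fun _ => 0)
    ?_ ?_ ?_ ?_ ?_
  · -- lam ≥ 0
    intro j j' s
    by_cases h : act s ∧ j' = c s ∧ j + 1 = ⌈t₁ - (c s : ℝ)⌉₊
    · have hl : lam j j' s = 1 := if_pos h; rw [hl]; exact zero_le_one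
    · have hl : lam j j' s = 0 := if_neg h; rw [hl]
  · -- lam supported on valid pairs
    intro j j' s hpos
    by_cases hcond : act s ∧ j' = c s ∧ j + 1 = ⌈t₁ - (c s : ℝ)⌉₊
    swap
    · have hl : lam j j' s = 0 := if_neg hcond
      rw [hl] at hpos; exact (lt_irrefl _ hpos).elim
    · obtain ⟨hact, hj', hj⟩ := hcond
      have h1 := H1 s hact
      have hpos' : 0 < t₁ - (c s : ℝ) := by linarith [(Nat.cast_nonneg (c s) : (0 : ℝ) ≤ c s)]
      have hceil := Nat.ceil_lt_add_one hpos'.le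
      have hlt : c s < ⌈t₁ - (c s : ℝ)⌉₊ := Nat.lt_ceil.2 (by linarith)
      have hjR : (j : ℝ) + 1 = (⌈t₁ - (c s : ℝ)⌉₊ : ℝ) := by exact_mod_cast hj
      refine ⟨by omega, ?_⟩
      rw [one_mul, hj']
      linarith
  · -- kap ≥ 0
    intro j j' a
    by_cases hj : j + 1 = ⌈t₂ - (j' : ℝ)⌉₊
    · have hl : kap j j' a = need a j' - need a (j' + 1) := if_pos hj; rw [hl]; linarith [Nmono a j' (j' + 1) (Nat.le_succ _)]
    · have hl : kap j j' a = 0 := if_neg hj; rw [hl]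
  · -- kap supported on valid pairs
    intro j j' a hpos
    by_cases hj : j + 1 = ⌈t₂ - (j' : ℝ)⌉₊
    swap
    · have hl : kap j j' a = 0 := if_neg hj
      rw [hl] at hpos; exact (lt_irrefl _ hpos).elim
    · have hl : kap j j' a = need a j' - need a (j' + 1) := if_pos hj
      rw [hl] at hpos
      have hne' : (if ∃ s' ∈ Finset.Icc j' M₂, U a s' then (1 : ℝ) else if ∃ s' ∈ Finset.Icc j' M₂, W a s' then r else 0) ≠ (if ∃ s' ∈ Finset.Icc (j' + 1) M₂, U a s' then (1 : ℝ) else if ∃ s' ∈ Finset.Icc (j' + 1) M₂, W a s' then r else 0) := by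
        intro h
        have hz : need a j' = need a (j' + 1) := by
          rw [hneed, hneed]; convert h using 4
        rw [hz, sub_self] at hpos; exact lt_irrefl _ hpos
      have hcell := need_drop_witness U W r M₂ a j' (by convert hne' using 5)
      have h2 := (hUW_low a j' hcell).1
      have hpos' : 0 < t₂ - (j' : ℝ) := by linarith [(Nat.cast_nonneg j' : (0 : ℝ) ≤ j')]
      have hceil := Nat.ceil_lt_add_one hpos'.le
      have hlt : j' < ⌈t₂ - (j' : ℝ)⌉₊ := Nat.lt_ceil.2 (by linarith)
      have hjR : (j : ℝ) + 1 = (⌈t₂ - (j' : ℝ)⌉₊ : ℝ) := by exact_mod_cast hj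
      refine ⟨by omega, ?_⟩
      rw [one_mul]
      linarith
  · -- the pointwise inequality
    intro a ha s hs
    rw [Finset.mem_range] at ha hs
    have hsM : s ≤ M₂ := by omega
    -- (1) collapse the row sum
    have hrow : ∑ j ∈ Finset.range (M₁ + 1), ∑ j' ∈ Finset.range (M₁ + 1), lam j j' s *
        ((1 - y) * 1 * (if j + 1 ≤ a then (1 : ℝ) else 0) - y * 1 * (if a ≤ j' then (1 : ℝ) else 0) - y * (1 - 1))
        = (if act s then (1 - y) * (if t₁ - c s ≤ (a : ℝ) then (1 : ℝ) else 0) - y * (if a ≤ c s then (1 : ℝ) else 0) else 0) := by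
      by_cases hact : act s
      · have h1 := H1 s hact
        have hpos' : 0 ≤ t₁ - (c s : ℝ) := by linarith [(Nat.cast_nonneg (c s) : (0 : ℝ) ≤ c s)]
        have hJ1 : 1 ≤ ⌈t₁ - (c s : ℝ)⌉₊ := by have : c s < ⌈t₁ - (c s : ℝ)⌉₊ := Nat.lt_ceil.2 (by linarith); omega
        have hcM : c s < M₁ + 1 := by
          have : (c s : ℝ) < t₁ := by linarith [(Nat.cast_nonneg (c s) : (0 : ℝ) ≤ c s)]
          have : (c s : ℝ) < M₁ := lt_of_lt_of_le this ht₁M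
          exact_mod_cast (show (c s : ℝ) < M₁ + 1 by linarith)
        have hJM : ⌈t₁ - (c s : ℝ)⌉₊ - 1 < M₁ + 1 := by
          have : ⌈t₁ - (c s : ℝ)⌉₊ ≤ M₁ := Nat.ceil_le.2 (by linarith [(Nat.cast_nonneg (c s) : (0 : ℝ) ≤ c s)])
          omega
        rw [Finset.sum_eq_single (⌈t₁ - (c s : ℝ)⌉₊ - 1)]
        · rw [Finset.sum_eq_single (c s)]
          · have hcond : act s ∧ c s = c s ∧ (⌈t₁ - (c s : ℝ)⌉₊ - 1) + 1 = ⌈t₁ - (c s : ℝ)⌉₊ := ⟨hact, rfl, by omega⟩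
            have hl : lam (⌈t₁ - (c s : ℝ)⌉₊ - 1) (c s) s = 1 := if_pos hcond
            rw [hl, if_pos hact, one_mul, mul_one, mul_one, sub_self, mul_zero, sub_zero]
            have e : ((⌈t₁ - (c s : ℝ)⌉₊ - 1) + 1 ≤ a) ↔ (t₁ - (c s : ℝ) ≤ (a : ℝ)) := by
              rw [Nat.sub_add_cancel hJ1]; exact Nat.ceil_le
            by_cases hca : t₁ - (c s : ℝ) ≤ (a : ℝ)
            · rw [if_pos (e.2 hca), if_pos hca]
            rw [if_neg (fun h => hca (e.1 h)), if_neg hca]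
          · intro j' _ hj'
            have hl : lam (⌈t₁ - (c s : ℝ)⌉₊ - 1) j' s = 0 := if_neg (fun h => hj' h.2.1)
            rw [hl, zero_mul]
          · intro hc; exact (hc (Finset.mem_range.2 hcM)).elim
        · intro j _ hj
          refine Finset.sum_eq_zero fun j' _ => ?_
          have hl : lam j j' s = 0 := if_neg (fun h => hj (by have := h.2.2; omega))
          rw [hl, zero_mul]
        · intro hJ; exact (hJ (Finset.mem_range.2 hJM)).elim
      · rw [if_neg hact]
        refine Finset.sum_eq_zero fun j _ => Finset.sum_eq_zero fun j' _ => ?_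
        have hl : lam j j' s = 0 := if_neg (fun h => hact h.1)
        rw [hl, zero_mul]
    -- (2) collapse the column sum
    have hcolj : ∀ j' ∈ Finset.range (M₂ + 1), ∑ j ∈ Finset.range (M₂ + 1), kap j j' a *
        ((1 - y) * 1 * (if j + 1 ≤ s then (1 : ℝ) else 0) - y * 1 * (if s ≤ j' then (1 : ℝ) else 0) - y * (1 - 1))
        = (need a j' - need a (j' + 1)) *
          ((1 - y) * (if t₂ - (j' : ℝ) ≤ (s : ℝ) then (1 : ℝ) else 0) - y * (if s ≤ j' then (1 : ℝ) else 0)) := by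
      intro j' hj'
      rw [Finset.mem_range] at hj'
      by_cases hΔ : need a j' - need a (j' + 1) = 0
      · rw [hΔ, zero_mul]
        refine Finset.sum_eq_zero fun j _ => ?_
        by_cases hj : j + 1 = ⌈t₂ - (j' : ℝ)⌉₊
        · have hl : kap j j' a = need a j' - need a (j' + 1) := if_pos hj; rw [hl, hΔ, zero_mul]
        · have hl : kap j j' a = 0 := if_neg hj; rw [hl, zero_mul]
      · -- a genuine drop: `(a, j′)` is a U/W cell, so `2j′ < t₂` and the pair index is in range
        have hne' : (if ∃ s' ∈ Finset.Icc j' M₂, U a s' then (1 : ℝ) else if ∃ s' ∈ Finset.Icc j' M₂, W a s' then r else 0) ≠ (if ∃ s' ∈ Finset.Icc (j' + 1) M₂, U a s' then (1 : ℝ) else if ∃ s' ∈ Finset.Icc (j' + 1) M₂, W a s' then r else 0) := by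
          intro h
          apply hΔ
          have hz : need a j' = need a (j' + 1) := by
            rw [hneed, hneed]; convert h using 4
          rw [hz, sub_self]
        have hcell := need_drop_witness U W r M₂ a j' (by convert hne' using 5)
        have h2 := (hUW_low a j' hcell).1
        have hpos' : 0 ≤ t₂ - (j' : ℝ) := by linarith [(Nat.cast_nonneg j' : (0 : ℝ) ≤ j')]
        have hJ1 : 1 ≤ ⌈t₂ - (j' : ℝ)⌉₊ := by have : j' < ⌈t₂ - (j' : ℝ)⌉₊ := Nat.lt_ceil.2 (by linarith); omega
        have hJM : ⌈t₂ - (j' : ℝ)⌉₊ - 1 < M₂ + 1 := by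
          have : ⌈t₂ - (j' : ℝ)⌉₊ ≤ M₂ := Nat.ceil_le.2 (by linarith [(Nat.cast_nonneg j' : (0 : ℝ) ≤ j')])
          omega
        rw [Finset.sum_eq_single (⌈t₂ - (j' : ℝ)⌉₊ - 1)]
        · have hcond : (⌈t₂ - (j' : ℝ)⌉₊ - 1) + 1 = ⌈t₂ - (j' : ℝ)⌉₊ := by omega
          have hl : kap (⌈t₂ - (j' : ℝ)⌉₊ - 1) j' a = need a j' - need a (j' + 1) := if_pos hcond
          rw [hl, mul_one, mul_one, sub_self, mul_zero, sub_zero]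
          have e : ((⌈t₂ - (j' : ℝ)⌉₊ - 1) + 1 ≤ s) ↔ (t₂ - (j' : ℝ) ≤ (s : ℝ)) := by
            rw [Nat.sub_add_cancel hJ1]; exact Nat.ceil_le
          by_cases hcs : t₂ - (j' : ℝ) ≤ (s : ℝ)
          · rw [if_pos (e.2 hcs), if_pos hcs]
          · rw [if_neg (fun h => hcs (e.1 h)), if_neg hcs]
        · intro j _ hj
          have hl : kap j j' a = 0 := if_neg (fun h => hj (by omega))
          rw [hl, zero_mul]
        · intro hJ; exact (hJ (Finset.mem_range.2 hJM)).elim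
    have hcol : ∑ j ∈ Finset.range (M₂ + 1), ∑ j' ∈ Finset.range (M₂ + 1), kap j j' a *
        ((1 - y) * 1 * (if j + 1 ≤ s then (1 : ℝ) else 0) - y * 1 * (if s ≤ j' then (1 : ℝ) else 0) - y * (1 - 1))
        = (1 - y) * need a ⌈t₂ - (s : ℝ)⌉₊ - y * need a s := by
      rw [Finset.sum_comm, Finset.sum_congr rfl hcolj]
      -- split into the two telescoping sums
      have e : ∀ j' : ℕ, (need a j' - need a (j' + 1)) *
          ((1 - y) * (if t₂ - (j' : ℝ) ≤ (s : ℝ) then (1 : ℝ) else 0) - y * (if s ≤ j' then (1 : ℝ) else 0))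
          = (1 - y) * (if ⌈t₂ - (s : ℝ)⌉₊ ≤ j' then need a j' - need a (j' + 1) else 0)
            - y * (if s ≤ j' then need a j' - need a (j' + 1) else 0) := by
        intro j'
        have hiff : (t₂ - (j' : ℝ) ≤ (s : ℝ)) ↔ (⌈t₂ - (s : ℝ)⌉₊ ≤ j') := by
          rw [Nat.ceil_le]; constructor <;> intro h <;> linarith
        by_cases h1 : t₂ - (j' : ℝ) ≤ (s : ℝ)
        · rw [if_pos h1, if_pos (hiff.1 h1)]
          split_ifs <;> ring
        · rw [if_neg h1, if_neg (fun h => h1 (hiff.2 h))]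
          split_ifs <;> ring
      simp_rw [e]
      rw [Finset.sum_sub_distrib, ← Finset.mul_sum, ← Finset.mul_sum]
      -- telescoping: `Σ_{j' ∈ range(M₂+1), m ≤ j'} (f j' − f (j'+1)) = f m` for `f` vanishing above `M₂`
      have htel : ∀ m : ℕ, ∑ j' ∈ Finset.range (M₂ + 1), (if m ≤ j' then need a j' - need a (j' + 1) else 0) = need a m := by
        intro m
        by_cases hm : m ≤ M₂ + 1
        · have hset : ∑ j' ∈ Finset.range (M₂ + 1), (if m ≤ j' then need a j' - need a (j' + 1) else 0)
              = ∑ j' ∈ Finset.Icc m M₂, (need a j' - need a (j' + 1)) := by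
            rw [← Finset.sum_filter]
            refine Finset.sum_congr ?_ fun _ _ => rfl
            ext j'; simp only [Finset.mem_filter, Finset.mem_range, Finset.mem_Icc]; omega
          rw [hset]
          exact sum_Icc_sub_succ_telescope (need a) M₂ m hm (Nvan a (M₂ + 1) (Nat.lt_succ_self _))
        · rw [Nvan a m (by omega)]
          refine Finset.sum_eq_zero fun j' hj' => ?_
          rw [Finset.mem_range] at hj'
          rw [if_neg (by omega)]
      rw [htel, htel]
    rw [hrow, hcol]
    simp only [zero_mul, add_zero]
    -- (3) the pointwise inequality of S*, then `K′ ≤ K`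
    have hpt := halfCert_pointwise y t₁ t₂ k a s hy hy1 hk2 act c H1 H2 H3 H4 need N0 N1 NU NW Npos
    have hKK : (1 - y) * (if t₁ + t₂ - k ≤ (a : ℝ) + s then (1 : ℝ) else 0) - y * (if a + s ≤ k then (1 : ℝ) else 0)
        ≤ (1 - y) * 1 * (if i + 1 ≤ a + s then (1 : ℝ) else 0) - y * 1 * (if a + s ≤ i' then (1 : ℝ) else 0) - y * (1 - 1) := by
      rw [mul_one, mul_one, sub_self, mul_zero, sub_zero]
      have himp : t₁ + t₂ - k ≤ (a : ℝ) + s → i + 1 ≤ a + s := by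
        intro h
        rw [one_mul] at hdeep
        have : (i : ℝ) < (a : ℝ) + s := by rw [hk] at h; linarith
        exact_mod_cast this
      by_cases h1 : t₁ + t₂ - k ≤ (a : ℝ) + s
      · rw [if_pos h1, if_pos (himp h1)]
      · rw [if_neg h1]
        have : 0 ≤ (1 - y) * (if i + 1 ≤ a + s then (1 : ℝ) else 0) := by
          split_ifs <;> nlinarith
        linarith
    have hadd : (if act s then (1 - y) * (if t₁ - c s ≤ (a : ℝ) then (1 : ℝ) else 0) - y * (if a ≤ c s then (1 : ℝ) else 0) else 0)
        + ((1 - y) * need a ⌈t₂ - (s : ℝ)⌉₊ - y * need a s)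
        = (if act s then (1 - y) * (if t₁ - c s ≤ (a : ℝ) then (1 : ℝ) else 0) - y * (if a ≤ c s then (1 : ℝ) else 0) else 0)
        + (1 - y) * need a ⌈t₂ - (s : ℝ)⌉₊ - y * need a s := by ring
    rw [hadd]
    exact le_trans hpt hKK

end LawDec

end Quant

end Summit.CriticalPhenomena.PercolationContinuityZ3.Theorems
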